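import Mathlib
import Summits.ValiantsHypothesis.ValiantsHypothesis.Theorems.FifoMatchingNNDivisionHardFreeBand
import HarnessLib

/-!
# Route FifoMatching — crux `NNDivisionHard` (stmt-ValiantsHypothesis-21181): INTERIOR CERTIFICATES HAVE
# `Ω(n^{1/3} / polylog n)` DISTINCT ARC LENGTHS (the pigeonhole of `…FewLengths.lean` with the padding length FREE)

`…FreeBand.lean` (`freeBandAvoiding_not_certificate_qp`) shows that for every admissible pair `(u, L)`
(`20 n (log₂ n + 1) ≤ u⁶`, `8u⁴ + 3u³ ≤ L`, `(24u + 7) L + 48u⁴ + 8u³ + 24u + 4 ≤ n`) a certificate cofactor `h` must have a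
variable `x_(i,j)` "possible at `(u, L)`"; for an INTERIOR variable (`L ≤ i`, `j + L < 2n`) this forces the arc length
`j − i` into the window `W(L) = [2L − 2u³ + 1, 2L + 2u³ − 1]` of width `< 4u³` around `2L`.  `…FewLengths.lean` ran the
pigeonhole over the parameter `u` at the tied padding length `L(u) = 8u⁴ + 3u³` (`Θ(n^{1/5})` lengths).  Here `u` is FIXED and
the padding length runs over the arithmetic progression `L_t = 8u⁴ + 3u³ + 2u³·t`, `t = 0, …, K`: the windows `W(L_t)` are
pairwise disjoint, so an interior cofactor (margin `Λ ≥ L_K`: every variable has `Λ ≤ i` and `j + Λ < 2n`) with at most `K`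
distinct arc lengths misses one of them and is not a certificate:

* `window_lt_window` — `t < t' ⇒ 2L_t + 2u³ − 1 < 2L_{t'} − 2u³ + 1` (disjoint windows);
* ★★ `manyLengths_not_certificate_qp` — **for every `c`, eventually in `n`: for all `u, Λ, K` with `20 n (log₂ n + 1) ≤ u⁶`,
  `L_K ≤ Λ` and `(24u + 7) L_K + 48u⁴ + 8u³ + 24u + 4 ≤ n`, every `h ≠ 0` all of whose variables `x_(i,j)` satisfy `Λ ≤ i`,
  `j + Λ < 2n` and whose variables have at most `K` distinct arc lengths `j − i` satisfies
  `2^((log₂ n + c)^c) < L₊(NN_n · h) + L₊(h)`.**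
  READING: with `u ≈ (20 n (log₂ n + 1))^{1/6}` and `Λ = L_K ≈ n / (24u + 7)`, `K ≈ n / (2u³ (24u + 7)) = Θ(n^{1/3} / log^{2/3} n)`:
  a certificate cofactor living on the middle `[Λ, 2n − Λ)` of the vertex set has `Ω(n^{1/3} / log^{2/3} n)` distinct arc
  lengths (against `Θ(n^{1/5})` from `…FewLengths.lean`).

HONEST FRAMING: a structural constraint on certificates for ONE candidate family (the (s1) step named by the previous hand);
stmt-21181 stays OPEN; nothing here bears on `NNNotVP` or on VP ≠ VNP (NOT proved).  No definitions, no named facts.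
References: Hrubeš–Yehudayoff 2021 §6 Problem 2 [HrubesYehudayoff2021]; Bürgisser 2000 Rem. 2.7 [Burgisser2000].
-/

noncomputable section

-- Sub = Summit single-conjunct layout: the duplicated namespace component is mandated by the tree.
set_option linter.dupNamespace false
set_option autoImplicit false

namespace Summit.ValiantsHypothesis.ValiantsHypothesis.Theorems.FifoMatching.NNDivisionHard.ManyLengths

open Finset MvPolynomial Literature.Computability.AlgebraicComplexity
open Summit.ValiantsHypothesis.ValiantsHypothesis.Theorems.FifoMatching.NNDivisionHard.FreeBand
  (freeBandAvoiding_not_certificate_qp)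
open scoped NNReal BigOperators

variable {n : ℕ}

/-- The windows `W(L_t) = [2L_t − 2u³ + 1, 2L_t + 2u³ − 1]`, `L_t = L₀ + 2u³ t`, are pairwise disjoint:
`t < t' ⇒ 2L_t + 2u³ − 1 < 2L_{t'} − 2u³ + 1`. [folklore] -/
theorem window_lt_window {u L₀ t t' : ℕ} (h : t < t') :
    2 * (L₀ + 2 * u ^ 3 * t) + 2 * u ^ 3 - 1 < 2 * (L₀ + 2 * u ^ 3 * t') - 2 * u ^ 3 + 1 := by
  have h1 : 2 * u ^ 3 * t + 2 * u ^ 3 ≤ 2 * u ^ 3 * t' := by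
    have : t + 1 ≤ t' := h
    calc 2 * u ^ 3 * t + 2 * u ^ 3 = 2 * u ^ 3 * (t + 1) := by ring
      _ ≤ 2 * u ^ 3 * t' := Nat.mul_le_mul_left _ this
  omega

/-- ★★ **INTERIOR CERTIFICATES HAVE MANY DISTINCT ARC LENGTHS (free padding length).**  For every `c`, eventually in `n`:
let `u, Λ, K` satisfy `20 n (log₂ n + 1) ≤ u⁶`, `L_K ≤ Λ` and `(24u + 7) L_K + 48u⁴ + 8u³ + 24u + 4 ≤ n`, where
`L_K = 8u⁴ + 3u³ + 2u³ K`; let `h ≠ 0` be an interior cofactor (`Λ ≤ i` and `j + Λ < 2n` for every variable `x_(i,j)` of `h`)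
whose variables have at most `K` distinct arc lengths `j − i`.  Then `2^((log₂ n + c)^c) < L₊(NN_n · h) + L₊(h)`.
[cite: HrubesYehudayoff2021, §6 Problem 2] [cite: Burgisser2000, Rem. 2.7] -/
theorem manyLengths_not_certificate_qp (c : ℕ) : ∃ n₀ : ℕ, ∀ n : ℕ, n₀ ≤ n → ∀ u Λ K : ℕ,
    20 * n * (Nat.log 2 n + 1) ≤ u ^ 6 →
    8 * u ^ 4 + 3 * u ^ 3 + 2 * u ^ 3 * K ≤ Λ →
    (24 * u + 7) * (8 * u ^ 4 + 3 * u ^ 3 + 2 * u ^ 3 * K) + 48 * u ^ 4 + 8 * u ^ 3 + 24 * u + 4 ≤ n →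
    ∀ h : MvPolynomial (Fin (2 * n) × Fin (2 * n)) ℝ≥0, h ≠ 0 →
      (∀ e ∈ h.vars, Λ ≤ (e.1 : ℕ) ∧ (e.2 : ℕ) + Λ < 2 * n) →
      (h.vars.image fun e => (e.2 : ℕ) - (e.1 : ℕ)).card ≤ K →
      2 ^ ((Nat.log 2 n + c) ^ c) < complexity (nestFreeMatchingPoly n ℝ≥0 * h) + complexity h := by
  classical
  obtain ⟨n₀, hn₀⟩ := freeBandAvoiding_not_certificate_qp c
  refine ⟨n₀, fun n hn u Λ K hlog hΛ hT h hh hint hfew => ?_⟩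
  set L₀ : ℕ := 8 * u ^ 4 + 3 * u ^ 3 with hL₀
  set Lset := h.vars.image fun e => (e.2 : ℕ) - (e.1 : ℕ) with hLset
  -- some `t ≤ K` has no arc length of `h` in its window `W(L_t)`
  have hmiss : ∃ t ∈ Finset.range (K + 1), ∀ e ∈ h.vars,
      ¬ (2 * (L₀ + 2 * u ^ 3 * t) - 2 * u ^ 3 + 1 ≤ (e.2 : ℕ) - (e.1 : ℕ) ∧
         (e.2 : ℕ) - (e.1 : ℕ) ≤ 2 * (L₀ + 2 * u ^ 3 * t) + 2 * u ^ 3 - 1) := by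
    by_contra hall
    push Not at hall
    have hch : ∀ t ∈ Finset.range (K + 1), ∃ ℓ ∈ Lset,
        2 * (L₀ + 2 * u ^ 3 * t) - 2 * u ^ 3 + 1 ≤ ℓ ∧ ℓ ≤ 2 * (L₀ + 2 * u ^ 3 * t) + 2 * u ^ 3 - 1 := by
      intro t ht
      obtain ⟨e, he, h1, h2⟩ := hall t ht
      exact ⟨(e.2 : ℕ) - (e.1 : ℕ), Finset.mem_image.2 ⟨e, he, rfl⟩, h1, h2⟩
    choose! g hg using hch
    have hinj : Set.InjOn g (Finset.range (K + 1)) := by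
      intro t ht t' ht' hgg
      obtain ⟨-, h1, h2⟩ := hg t ht
      obtain ⟨-, h1', h2'⟩ := hg t' ht'
      rw [hgg] at h1 h2
      by_contra hne
      rcases lt_or_gt_of_ne hne with hlt | hlt
      · have := window_lt_window (u := u) (L₀ := L₀) hlt
        omega
      · have := window_lt_window (u := u) (L₀ := L₀) hlt
        omega
    have hle : (Finset.range (K + 1)).card ≤ Lset.card :=
      Finset.card_le_card_of_injOn g (fun t ht => (hg t ht).1) hinj
    rw [Finset.card_range] at hle
    omega
  obtain ⟨t, ht, hno⟩ := hmiss
  rw [Finset.mem_range] at ht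
  -- the pair `(u, L_t)` is admissible
  have htK : 2 * u ^ 3 * t ≤ 2 * u ^ 3 * K := Nat.mul_le_mul_left _ (by omega)
  have hLt : L₀ + 2 * u ^ 3 * t ≤ Λ := by omega
  have hTt : (24 * u + 7) * (L₀ + 2 * u ^ 3 * t) + 48 * u ^ 4 + 8 * u ^ 3 + 24 * u + 4 ≤ n := by
    have : (24 * u + 7) * (L₀ + 2 * u ^ 3 * t) ≤ (24 * u + 7) * (L₀ + 2 * u ^ 3 * K) :=
      Nat.mul_le_mul_left _ (by omega)
    omega
  refine hn₀ n hn u (L₀ + 2 * u ^ 3 * t) hlog (by omega) hTt h hh fun e he hQ => ?_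
  obtain ⟨hmid, hlo, hhi⟩ := hQ
  obtain ⟨hi1, hi2⟩ := hint e he
  have h3 := hmid (le_trans hLt hi1) (by omega)
  exact hno e he ⟨by omega, by omega⟩

end Summit.ValiantsHypothesis.ValiantsHypothesis.Theorems.FifoMatching.NNDivisionHard.ManyLengths

end
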